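import Mathlib
import HarnessLib
import Summits.NavierStokesRegularity.NavierStokesRegularity.Theorems.HalfSpaceWindowDoorCirculationCarryingRigidityConeSupportRigidity
import Summits.NavierStokesRegularity.NavierStokesRegularity.Theorems.HalfSpaceWindowDoorCirculationCarryingRigidityCriticalStretchingAnalytic
import Summits.NavierStokesRegularity.NavierStokesRegularity.Theorems.AxisTwistDoorAveragedConeLiouvilleFlatFlux
import Summits.NavierStokesRegularity.NavierStokesRegularity.Theorems.AxisTwistDoorAveragedConeLiouvilleCircleCalculus

/-!
# Route `HalfSpaceWindowDoor`, crux `CirculationCarryingRigidity` (stmt-NavierStokesRegularity-25311) —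
# line `cone_sweep`, RADIAL form, Step 3: support rigidity under the RADIAL circle cone on far circles about one axis

LEAD ns-hsw-p1 g9, `--supports stmt-NavierStokesRegularity-25311 --as helper`; card `Cruxes/…/Lines/cone_sweep.md`.  Generalisation of
`…FarConeRigidity` (p684322): the cone-line monotonicity of `Γ` needs only the RADIAL circle cone `∮|ω_r| dl ≤ K∮ω₃ dl`
(`|∮ω_r dl| ≤ ∮|ω_r| dl`, `abs_radVortCirc_le_rad`; `circ_radConeLine_mono`), and a slice whose circulation is saturated by a disc
`D(R,z₀)`, `R ≥ ρ₀`, has `Γ(·,z,s₀) ≡ S` beyond the cone line `R + K|z − z₀|`, hence `ω₃(s₀,·) = 0` on an open set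
(`inner_curl_e3_eq_zero_on_circle_of_const` — no cone needed on the circle) and, by real-analyticity of the slice `ω₃(s₀,·)`
(`inner_curl_e3_eq_const_of_ball`), `ω₃(s₀,·) ≡ 0` on `ℝ³` and `Γ(·,·,s₀) ≡ 0` (`inner_curl_e3_eq_zero_of_saturated_rad`,
`circ_eq_zero_of_saturated_rad`).  The azimuthal vorticity `ω_θ` is never used.  Consumed by `…RadConeLiouville`.
WHAT THIS IS NOT: not about NS regularity; HYPOTHETICAL profiles.  No item is closed by this file.
-/

noncomputable section

-- the summit and its single sub-problem share the name (CONVENTIONS §1), as in every Theorems file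
set_option linter.dupNamespace false

namespace Summit.NavierStokesRegularity.NavierStokesRegularity.Theorems.HalfSpaceWindowDoorCirculationCarryingRigidityRadConeRigidity

open MeasureTheory Set Function Filter Topology InnerProductSpace
open scoped RealInnerProductSpace InnerProductSpace
open Literature.Analysis Literature.Analysis.UnboundedOperators
open Literature.Analysis.FluidPDE hiding eR
open Summit.NavierStokesRegularity.NavierStokesRegularity.Theses.HalfSpaceWindowDoor
open Summit.NavierStokesRegularity.NavierStokesRegularity.Theorems.HalfSpaceWindowDoorCirculationCarryingRigidityDefs
  (InDoorClass SignE3 e3)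
open Summit.NavierStokesRegularity.NavierStokesRegularity.Theorems.AxisTwistDoorAveragedConeLiouvilleDefs
  (cylPt eT eR circ vortCirc radVortCirc)
open Summit.NavierStokesRegularity.NavierStokesRegularity.Theorems.AveragedConeLiouville.CircleStokes
  (hasDerivAt_circ deriv_circ_eq_vortCirc inner_e3 continuous_eR)
open Summit.NavierStokesRegularity.NavierStokesRegularity.Theorems.AveragedConeLiouville.CircMonotone
  (circ_zero circ_mono circ_nonneg vortCirc_nonneg)
open Summit.NavierStokesRegularity.NavierStokesRegularity.Theorems.AveragedConeLiouville.FlatFlux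
  (eq_zero_of_integral_eq_zero_of_nonneg exists_cylPt_eq)
open Summit.NavierStokesRegularity.NavierStokesRegularity.Theorems.AxisTwistDoorAveragedConeLiouvilleCylFrame (continuous_cylPt_θ)
open Summit.NavierStokesRegularity.NavierStokesRegularity.Theorems.HalfSpaceWindowDoorCirculationCarryingRigidityCriticalStretchingAnalytic
  (inner_curl_e3_eq_const_of_ball)
open Summit.NavierStokesRegularity.NavierStokesRegularity.Theorems.HalfSpaceWindowDoorCirculationCarryingRigidityConeFluxSubsolution
  (signE3_atd contDiff_one_slice)
open Summit.NavierStokesRegularity.NavierStokesRegularity.Theorems.HalfSpaceWindowDoorCirculationCarryingRigidityConeSupportRigidity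
  (hasDerivAt_circ_line)

variable {C : ℝ} {v : ℝ → EuclideanSpace ℝ (Fin 3) → EuclideanSpace ℝ (Fin 3)}

/-! ### The radial-vorticity line integral against its absolute form -/

/-- `|∮_{S(r,z)} ω_r dl| ≤ ∮_{S(r,z)} |ω_r| dl` (`r ≥ 0`). -/
theorem abs_radVortCirc_le_rad {s : ℝ} (hv1 : ContDiff ℝ 1 (v s)) {r : ℝ} (hr : 0 ≤ r) (z : ℝ) :
    |radVortCirc v r z s| ≤ ∫ θ in (0 : ℝ)..(2 * Real.pi), |⟪curl (v s) (cylPt r θ z), eR θ⟫| * r := by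
  have hωc : Continuous fun θ => curl (v s) (cylPt r θ z) := by
    have hD : Continuous (fderiv ℝ (v s)) := hv1.continuous_fderiv one_ne_zero
    have e : curl (v s) = fun x => curlCLM (fderiv ℝ (v s) x) := by funext x; exact curl_eq_curlCLM (v s) x
    rw [e]
    exact (curlCLM.continuous.comp hD).comp (continuous_cylPt_θ r z)
  unfold radVortCirc
  have h1 : |∫ θ in (0 : ℝ)..(2 * Real.pi), ⟪curl (v s) (cylPt r θ z), eR θ⟫ * r| ≤
      ∫ θ in (0 : ℝ)..(2 * Real.pi), |⟪curl (v s) (cylPt r θ z), eR θ⟫ * r| :=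
    intervalIntegral.abs_integral_le_integral_abs (by positivity)
  refine h1.trans (le_of_eq (intervalIntegral.integral_congr fun θ _ => ?_))
  simp only [abs_mul, abs_of_nonneg hr]

/-! ### Monotonicity of `Γ` along the cone lines, radial form -/

/-- **`Γ` is non-decreasing along the cone lines `h ↦ (R + Kh, z₀ ± h)`, `h ≥ 0`, `R ≥ ρ₀`**, given the RADIAL circle cone
`∮|ω_r| dl ≤ K∮ω₃ dl` on the circles of radius `≥ ρ₀` of the slice:  `d/dh Γ = K∮ω₃ ∓ ∮ω_r ≥ 0`. -/
theorem circ_radConeLine_mono (hv : InDoorClass C v) {K : ℝ} (hK : 0 ≤ K) {s : ℝ} (hs : s < 0) {ρ₀ : ℝ} (hρ₀ : 0 ≤ ρ₀)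
    (hcone : ∀ r : ℝ, ρ₀ ≤ r → ∀ z : ℝ,
      (∫ θ in (0 : ℝ)..(2 * Real.pi), |⟪curl (v s) (cylPt r θ z), eR θ⟫| * r) ≤ K * vortCirc v r z s)
    {R : ℝ} (hR : ρ₀ ≤ R) (z₀ : ℝ) {ε : ℝ} (hε : ε = 1 ∨ ε = -1) :
    MonotoneOn (fun h => circ v (R + K * h) (z₀ + ε * h) s) (Ici 0) := by
  have hv1 := contDiff_one_slice hv hs
  have hd := fun h => hasDerivAt_circ_line hv hs R K z₀ ε h
  refine monotoneOn_of_deriv_nonneg (convex_Ici 0) ?_ ?_ fun h hh => ?_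
  · exact (continuous_iff_continuousAt.2 fun h => (hd h).continuousAt).continuousOn
  · intro h _; exact (hd h).differentiableAt.differentiableWithinAt
  · rw [interior_Ici] at hh
    rw [(hd h).deriv]
    have hh' := le_of_lt (mem_Ioi.1 hh)
    have hrρ : ρ₀ ≤ R + K * h := hR.trans (by nlinarith)
    have hr0 : 0 ≤ R + K * h := hρ₀.trans hrρ
    have h1 := abs_radVortCirc_le_rad hv1 hr0 (z₀ + ε * h)
    have h2 := hcone _ hrρ (z₀ + ε * h)
    have h3 := (abs_le.1 (h1.trans h2))
    rcases hε with e | e <;> subst e <;> nlinarith [h3.1, h3.2]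

/-! ### `ω₃` vanishes on a circle across which `Γ` is locally constant (no cone needed) -/

/-- If `Γ(·, z, s)` is locally constant near `r > 0`, then `∮_{S(r,z)}ω₃ dl = ∂ᵣΓ = 0` and, `ω₃` being one-signed, `ω₃ = 0` on the
circle `S(r,z)` (angles in `(0, 2π)`). -/
theorem inner_curl_e3_eq_zero_on_circle_of_const {s : ℝ} (hv : ContDiff ℝ 1 (v s))
    (hsign : ∀ y, 0 ≤ ⟪curl (v s) y, Summit.NavierStokesRegularity.NavierStokesRegularity.Theorems.AxisTwistDoorAveragedConeLiouvilleDefs.e3⟫)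
    {r z c : ℝ} (hr : 0 < r) (hcirc : (fun r' => circ v r' z s) =ᶠ[𝓝 r] fun _ => c) {θ : ℝ} (hθ : θ ∈ Ioo (0 : ℝ) (2 * Real.pi)) :
    ⟪curl (v s) (cylPt r θ z), Summit.NavierStokesRegularity.NavierStokesRegularity.Theorems.AxisTwistDoorAveragedConeLiouvilleDefs.e3⟫ = 0 := by
  have hvort : vortCirc v r z s = 0 := by
    rw [← deriv_circ_eq_vortCirc v hv r z, hcirc.deriv_eq, deriv_const]
  have hωc : Continuous fun θ => curl (v s) (cylPt r θ z) := by
    have hD : Continuous (fderiv ℝ (v s)) := hv.continuous_fderiv one_ne_zero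
    have e : curl (v s) = fun x => curlCLM (fderiv ℝ (v s) x) := by funext x; exact curl_eq_curlCLM (v s) x
    rw [e]
    exact (curlCLM.continuous.comp hD).comp (continuous_cylPt_θ r z)
  have hfc : Continuous fun θ => ⟪curl (v s) (cylPt r θ z),
      Summit.NavierStokesRegularity.NavierStokesRegularity.Theorems.AxisTwistDoorAveragedConeLiouvilleDefs.e3⟫ * r :=
    (hωc.inner continuous_const).mul continuous_const
  have hint : ∫ θ in (0 : ℝ)..(2 * Real.pi), ⟪curl (v s) (cylPt r θ z),
      Summit.NavierStokesRegularity.NavierStokesRegularity.Theorems.AxisTwistDoorAveragedConeLiouvilleDefs.e3⟫ * r = 0 := hvort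
  have h := eq_zero_of_integral_eq_zero_of_nonneg hfc (fun θ => mul_nonneg (hsign _) hr.le) hint hθ
  exact (mul_eq_zero.1 h).resolve_right hr.ne'

/-! ### Saturated circulation ⇒ the slice is poloidal and carries no circulation -/

/-- **SUPPORT RIGIDITY, radial form.**  A closed-hemisphere door-class profile with the RADIAL circle cone on the circles of radius `≥ ρ₀`
of ONE slice `s₀`, whose circulation on that slice is SATURATED by a disc `D(R, z₀)` with `R ≥ ρ₀` (`Γ(R,z₀,s₀) = S ≥ Γ` everywhere on the
slice), has `ω₃(s₀, ·) ≡ 0`: `Γ ≡ S` beyond the cone line, so `ω₃(s₀,·) = 0` on an open set, and the real-analytic slice `ω₃(s₀,·)`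
vanishes identically. -/
theorem inner_curl_e3_eq_zero_of_saturated_rad (hv : InDoorClass C v) (hsign : SignE3 v) {K : ℝ} (hK : 0 ≤ K)
    {s₀ : ℝ} (hs₀ : s₀ < 0) {ρ₀ : ℝ} (hρ₀ : 0 ≤ ρ₀)
    (hcone : ∀ r : ℝ, ρ₀ ≤ r → ∀ z : ℝ,
      (∫ θ in (0 : ℝ)..(2 * Real.pi), |⟪curl (v s₀) (cylPt r θ z), eR θ⟫| * r) ≤ K * vortCirc v r z s₀)
    {R z₀ S : ℝ} (hR : ρ₀ ≤ R) (hsat : circ v R z₀ s₀ = S) (hle : ∀ r : ℝ, 0 ≤ r → ∀ z : ℝ, circ v r z s₀ ≤ S) :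
    ∀ y, ⟪curl (v s₀) y, e3⟫ = 0 := by
  have hR0 : 0 ≤ R := hρ₀.trans hR
  have hv1 := contDiff_one_slice hv hs₀
  have hsign' : ∀ y, 0 ≤ ⟪curl (v s₀) y,
      Summit.NavierStokesRegularity.NavierStokesRegularity.Theorems.AxisTwistDoorAveragedConeLiouvilleDefs.e3⟫ :=
    fun y => signE3_atd hsign s₀ hs₀ y
  -- along the cone lines the disc stays saturated: `Γ(R + K|z − z₀|, z, s₀) = S`
  have hline : ∀ z : ℝ, circ v (R + K * |z - z₀|) z s₀ = S := by
    intro z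
    refine le_antisymm (hle _ (by positivity) z) ?_
    rcases le_or_gt z₀ z with hz | hz
    · have h := circ_radConeLine_mono hv hK hs₀ hρ₀ hcone hR z₀ (ε := 1) (Or.inl rfl) (self_mem_Ici)
        (mem_Ici.2 (sub_nonneg.2 hz)) (sub_nonneg.2 hz)
      have e1 : circ v (R + K * 0) (z₀ + 1 * 0) s₀ = S := by rw [mul_zero, add_zero, mul_zero, add_zero, hsat]
      have e2 : circ v (R + K * (z - z₀)) (z₀ + 1 * (z - z₀)) s₀ = circ v (R + K * |z - z₀|) z s₀ := by
        rw [abs_of_nonneg (sub_nonneg.2 hz), one_mul, add_sub_cancel]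
      have h' : circ v (R + K * 0) (z₀ + 1 * 0) s₀ ≤ circ v (R + K * (z - z₀)) (z₀ + 1 * (z - z₀)) s₀ := h
      rw [e1, e2] at h'
      exact h'
    · have h := circ_radConeLine_mono hv hK hs₀ hρ₀ hcone hR z₀ (ε := -1) (Or.inr rfl) (self_mem_Ici)
        (mem_Ici.2 (sub_nonneg.2 hz.le)) (sub_nonneg.2 hz.le)
      have e1 : circ v (R + K * 0) (z₀ + -1 * 0) s₀ = S := by rw [mul_zero, add_zero, mul_zero, add_zero, hsat]
      have e2 : circ v (R + K * (z₀ - z)) (z₀ + -1 * (z₀ - z)) s₀ = circ v (R + K * |z - z₀|) z s₀ := by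
        rw [abs_of_neg (sub_neg.2 hz), neg_sub, show z₀ + -1 * (z₀ - z) = z by ring]
      have h' : circ v (R + K * 0) (z₀ + -1 * 0) s₀ ≤ circ v (R + K * (z₀ - z)) (z₀ + -1 * (z₀ - z)) s₀ := h
      rw [e1, e2] at h'
      exact h'
  -- beyond the cone line `Γ(·, z, s₀) ≡ S`
  have hconst : ∀ z r : ℝ, R + K * |z - z₀| ≤ r → circ v r z s₀ = S := fun z r hr =>
    le_antisymm (hle r ((by positivity : (0:ℝ) ≤ R + K * |z - z₀|).trans hr) z)
      ((hline z).symm.le.trans (circ_mono v hv1 (signE3_atd hsign) hs₀ (by positivity) hr z))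
  -- the open `ω₃`-free region `{y₁ > 0, (R + K|y₂ − z₀| + 1)² < y₀² + y₁²}`
  set U : Set (EuclideanSpace ℝ (Fin 3)) := {y | 0 < y 1 ∧ (R + K * |y 2 - z₀| + 1) ^ 2 < y 0 ^ 2 + y 1 ^ 2} with hU
  have hcont_yi : ∀ i : Fin 3, Continuous fun y : EuclideanSpace ℝ (Fin 3) => y i := fun i =>
    (continuous_apply i).comp (PiLp.continuous_ofLp 2 _)
  have hUo : IsOpen U := by
    refine (isOpen_lt continuous_const (hcont_yi 1)).inter (isOpen_lt ?_ (((hcont_yi 0).pow 2).add ((hcont_yi 1).pow 2)))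
    exact ((continuous_const.add (continuous_const.mul (((hcont_yi 2).sub continuous_const).abs))).add continuous_const).pow 2
  set p₀ : EuclideanSpace ℝ (Fin 3) := cylPt (R + 2) (Real.pi / 2) z₀ with hp₀
  have hp₀U : p₀ ∈ U := by
    refine ⟨?_, ?_⟩
    · show 0 < (cylPt (R + 2) (Real.pi / 2) z₀) 1
      simp [cylPt]; linarith
    · show (R + K * |(cylPt (R + 2) (Real.pi / 2) z₀) 2 - z₀| + 1) ^ 2 <
        (cylPt (R + 2) (Real.pi / 2) z₀) 0 ^ 2 + (cylPt (R + 2) (Real.pi / 2) z₀) 1 ^ 2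
      simp [cylPt]; nlinarith
  -- `ω₃(s₀, ·) = 0` on `U`
  have hzeroU : ∀ y ∈ U, ⟪curl (v s₀) y, e3⟫ = 0 := by
    intro y hy
    obtain ⟨hy1, hy2⟩ := hy
    obtain ⟨r, θ, hr, hr2, hθ, hyeq⟩ := exists_cylPt_eq hy1
    have hy2' : (R + K * |y 2 - z₀| + 1) ^ 2 < r ^ 2 := by rw [hr2]; exact hy2
    have hRr : R + K * |y 2 - z₀| + 1 < r := by
      have h0 : 0 ≤ R + K * |y 2 - z₀| + 1 := by positivity
      nlinarith
    rw [← hyeq]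
    refine inner_curl_e3_eq_zero_on_circle_of_const hv1 hsign' hr (c := S) ?_ hθ
    filter_upwards [Ioi_mem_nhds (show R + K * |y 2 - z₀| < r by linarith)] with r' hr'
    exact hconst (y 2) r' (le_of_lt hr')
  -- a ball inside `U`, then the identity theorem for the real-analytic slice `ω₃(s₀, ·)`
  obtain ⟨ρ, hρ, hball⟩ := Metric.isOpen_iff.1 hUo p₀ hp₀U
  exact inner_curl_e3_eq_const_of_ball hv.1 hv.2.1 hv.2.2.1 hs₀ hρ (x₀ := p₀) (m := 0) fun y hy =>
    hzeroU y (hball (by rwa [Metric.mem_ball, dist_eq_norm]))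

/-- **Corollary.**  Under the hypotheses of `inner_curl_e3_eq_zero_of_saturated_rad` the saturated slice carries NO circulation:
`Γ(r, z, s₀) = 0` for all `r ≥ 0`, `z` (in particular `S = 0`). -/
theorem circ_eq_zero_of_saturated_rad (hv : InDoorClass C v) (hsign : SignE3 v) {K : ℝ} (hK : 0 ≤ K)
    {s₀ : ℝ} (hs₀ : s₀ < 0) {ρ₀ : ℝ} (hρ₀ : 0 ≤ ρ₀)
    (hcone : ∀ r : ℝ, ρ₀ ≤ r → ∀ z : ℝ,
      (∫ θ in (0 : ℝ)..(2 * Real.pi), |⟪curl (v s₀) (cylPt r θ z), eR θ⟫| * r) ≤ K * vortCirc v r z s₀)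
    {R z₀ S : ℝ} (hR : ρ₀ ≤ R) (hsat : circ v R z₀ s₀ = S) (hle : ∀ r : ℝ, 0 ≤ r → ∀ z : ℝ, circ v r z s₀ ≤ S) :
    ∀ r z : ℝ, circ v r z s₀ = 0 := by
  have hv1 := contDiff_one_slice hv hs₀
  have hω := inner_curl_e3_eq_zero_of_saturated_rad hv hsign hK hs₀ hρ₀ hcone hR hsat hle
  intro r z
  -- `∂ᵣΓ(·, z, s₀) = ∮ω₃ dl = 0`, `Γ(0, z, s₀) = 0`
  have hvort : ∀ r' : ℝ, vortCirc v r' z s₀ = 0 := by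
    intro r'
    have hint : (fun θ : ℝ => ⟪curl (v s₀) (cylPt r' θ z),
        Summit.NavierStokesRegularity.NavierStokesRegularity.Theorems.AxisTwistDoorAveragedConeLiouvilleDefs.e3⟫ * r') =
        fun _ => (0 : ℝ) := by
      funext θ
      rw [show ⟪curl (v s₀) (cylPt r' θ z),
        Summit.NavierStokesRegularity.NavierStokesRegularity.Theorems.AxisTwistDoorAveragedConeLiouvilleDefs.e3⟫ = 0 from hω _, zero_mul]
    unfold vortCirc
    rw [hint, intervalIntegral.integral_const, smul_zero]
  have hderiv : ∀ r' : ℝ, HasDerivAt (fun ρ => circ v ρ z s₀) 0 r' := by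
    intro r'
    have h := hasDerivAt_circ v hv1 r' z
    rw [hvort r'] at h
    exact h
  have hconst := is_const_of_deriv_eq_zero (f := fun ρ => circ v ρ z s₀) (fun r' => (hderiv r').differentiableAt)
    (fun r' => (hderiv r').deriv) r 0
  have h0 : circ v 0 z s₀ = 0 := circ_zero v z s₀
  simpa [h0] using hconst

end Summit.NavierStokesRegularity.NavierStokesRegularity.Theorems.HalfSpaceWindowDoorCirculationCarryingRigidityRadConeRigidity

end
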